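import Literature.NumberTheory.ConnesConsani2024.ProlateWaveHermiteCombinationsProofs
import Literature.NumberTheory.ConnesConsani2021.SoninTraceReduction
import Literature.Analysis.SegalBargmann.FockHermiteComplete
import Mathlib.Analysis.Fourier.FourierTransformDeriv
import Mathlib.Analysis.SpecialFunctions.Gaussian.FourierTransform
import HarnessLib

/-!
# Connes–Consani–Moscovici 2024, Proposition 3.1 — PROVED: cyclicity of the scaling pair `(𝕊, h₀)`
# and its Fourier grading (RH-FREE corpus literature)

RH-FREE corpus literature (label, line 1): Hermite/Fourier analysis on `L²(ℝ)`; bears on the sequel row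
CCM2024 §3 of the cell's Connes–Consani corpus (no leaf role); nothing here bears on the truth of RH.

This is the theorems-only companion discharging seat t12's named fact
`Literature.NumberTheory.ConnesConsani2024.CCM2024_prop_3_1` (`ProlateWaveCyclicPairs.lean`):
Proposition 3.1 of [CCM2024] ("(i) `𝒱 = ℳ ∘ 𝒰` gives the canonical form of the cyclic pair `(𝕊, ξ_∞)`,
`ξ_∞ = h_0`; (ii) `(𝕊, ξ_∞)` is even with grading `𝔽_{e_ℝ}`"), typed as the conjunction of

1. CYCLICITY: the Gaussian core `{P(x²)e^{−πx²}}` is `L²`-dense in `L²(ℝ)^{ev}` (the tree's `evenPart`);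
2. `𝓕 h_0 = h_0`;
3. `𝓕² = 1` on `L²(ℝ)^{ev}`;
4. `𝓕𝕊 = −𝕊𝓕` on the Gaussian core `{P(x)e^{−πx²}}`.

## Proof (printed, p. 10: "we just need to check the cyclicity, i.e. that the vectors `𝕊ʲξ_∞` are
## dense … it follows from Proposition 3.2 which shows that `⋃ E_n` is the space of functions of the
## form `P(x²)e^{−πx²}`"; the density of the latter = completeness of the (even) Hermite functions,
## Thm. 3.1: "the `h_n` form an orthonormal basis")

* (1) Completeness of the Hermite functions `(polynomial)·e^{−π|x|²}` in `L²(ℝⁿ)` is the tree's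
  Folland §1.7 (vii) (`Literature.Analysis.SegalBargmann.hermite_complete`, same Gaussian `e^{−π|x|²}`
  as CCM); we transport it to `ℝ = ℝ^{Unit}` (`ae_eq_zero_of_forall_integral_mul_pow_gauss`) and then
  argue inside the closed subspace `evenPart`: with `K` the closure of the span of the even monomials
  `x^{2k}e^{−πx²}`, an even `ξ` decomposes as `ξ = y + z`, `y ∈ K`, `z ⊥ K`; `z` is even and orthogonal
  to the even monomials, hence (parity of the integral) to the odd ones too, hence `z = 0`.
* (2) Mathlib's `fourier_gaussian_pi` (`e^{−πx²}` is self-dual) and `h_0 = 2^{1/4}e^{−πx²}`.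
* (3) is the tree theorem `ConnesConsani2021.fourier_fourier_of_mem_evenPart` (seat gm-t15:
  `𝓕𝓕 = R` on `L²`, `R = 1` on even functions) — cited, not re-proved.
* (4) For `g = P(x)e^{−πx²}` (integrable together with all `x^k g` and `g′`): Mathlib's
  `Real.fourier_deriv` (`𝓕(g′)(ξ) = 2πiξ·𝓕g(ξ)`) and `Real.deriv_fourier` (`(𝓕g)′ = 𝓕(−2πix·g)`) give
  `𝓕(x g′) = −(𝓕g + ξ(𝓕g)′)`, whence `𝓕(𝕊g) = −𝕊(𝓕g)` for `𝕊 = −i(x∂ₓ + ½)`.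

## References
* [ConnesConsaniMoscovici2024] A. Connes, C. Consani, H. Moscovici, *Zeta zeros and prolate wave
  operators*, Ann. Funct. Anal. 15 (2024); arXiv:2310.18423, Prop. 3.1 p. 10 (chunk p0008:L89–L101),
  Prop. 3.2 p. 11, Thm. 3.1 p. 9.
* [Folland1989] G. B. Folland, *Harmonic Analysis in Phase Space*, §1.7 (vii) (completeness of the
  Hermite functions) — tree file `Analysis/SegalBargmann/FockHermiteComplete.lean`.
-/

noncomputable section

open MeasureTheory Complex Polynomial
open scoped Real FourierTransform ComplexConjugate InnerProductSpace ENNReal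

namespace Literature.NumberTheory.ConnesConsani2024

open Literature.NumberTheory.LFunctions Literature.NumberTheory.ConnesConsani2021

/-! ## Integrability of the Gaussian core -/

/-- RH-FREE. `x ↦ x^n e^{−bx²}` is integrable on `ℝ` for `b > 0`. [folklore] -/
private theorem integrable_pow_mul_exp_neg {b : ℝ} (hb : 0 < b) (n : ℕ) :
    Integrable (fun x : ℝ => x ^ n * Real.exp (-b * x ^ 2)) := by
  have h := integrable_rpow_mul_exp_neg_mul_sq hb (s := n)
    (by have := n.cast_nonneg (α := ℝ); linarith)
  refine h.congr (Filter.Eventually.of_forall fun x => ?_)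
  simp only [Real.rpow_natCast]

/-- RH-FREE. The monomial Gaussian `x ↦ x^n e^{−πx²}` as a complex-valued function. [folklore] -/
private def monoGauss (n : ℕ) (x : ℝ) : ℂ := (((x ^ n * Real.exp (-π * x ^ 2) : ℝ)) : ℂ)

/-- RH-FREE. Unfolding of the monomial Gaussian. [folklore] -/
private theorem monoGauss_apply (n : ℕ) (x : ℝ) :
    monoGauss n x = (x : ℂ) ^ n * ((Real.exp (-π * x ^ 2) : ℝ) : ℂ) := by
  simp only [monoGauss]
  push_cast
  ring

/-- RH-FREE. The monomial Gaussian is continuous. [folklore] -/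
private theorem continuous_monoGauss (n : ℕ) : Continuous (monoGauss n) := by
  unfold monoGauss
  fun_prop

/-- RH-FREE. `x^n e^{−πx²} ∈ L¹(ℝ)`. [folklore] -/
private theorem integrable_monoGauss (n : ℕ) : Integrable (monoGauss n) :=
  (integrable_pow_mul_exp_neg Real.pi_pos n).ofReal

/-- RH-FREE. `x^n e^{−πx²} ∈ L²(ℝ)` (its square is `x^{2n}e^{−2πx²} ∈ L¹`). [folklore] -/
private theorem memLp_monoGauss (n : ℕ) : MemLp (monoGauss n) 2 (volume : Measure ℝ) := by
  rw [memLp_two_iff_integrable_sq_norm (continuous_monoGauss n).aestronglyMeasurable]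
  have h := integrable_pow_mul_exp_neg (b := 2 * π) (by positivity) (2 * n)
  refine h.congr (Filter.Eventually.of_forall fun x => ?_)
  simp only [monoGauss, Complex.norm_real, Real.norm_eq_abs, sq_abs]
  rw [mul_pow, pow_mul, ← Real.exp_nat_mul]
  congr 1
  · ring
  · congr 1
    push_cast
    ring

/-- RH-FREE. The Gaussian core as a finite sum of monomial Gaussians. [folklore] -/
private theorem gaussPolyFn_eq_sum' (P : ℂ[X]) :
    gaussPolyFn P = fun x : ℝ =>
      ∑ i ∈ Finset.range (P.natDegree + 1), P.coeff i * monoGauss i x := by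
  funext x
  rw [gaussPolyFn, eval_eq_sum_range, Finset.sum_mul]
  refine Finset.sum_congr rfl fun i _ => ?_
  rw [monoGauss_apply]
  ring

/-- RH-FREE. **Every `P(x)e^{−πx²}` is integrable on `ℝ`** (the Gaussian core lies in `L¹`, as the proof
of Thm. 3.1/Prop. 3.1 uses throughout: Mellin and Fourier integrals on `E_n`).
[cite: ConnesConsaniMoscovici2024, Thm. 3.1 proof p. 10 (p0008:L23–L60)] -/
theorem integrable_gaussPolyFn (P : ℂ[X]) : Integrable (gaussPolyFn P) := by
  rw [gaussPolyFn_eq_sum' P]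
  refine integrable_finsetSum _ fun i _ => ?_
  exact (integrable_monoGauss i).const_mul _

/-- RH-FREE. `x · (P(x)e^{−πx²}) = (XP)(x)e^{−πx²}` (real scalar action). [folklore] -/
private theorem smul_gaussPolyFn (P : ℂ[X]) :
    (fun x : ℝ => x • gaussPolyFn P x) = gaussPolyFn (X * P) := by
  funext x
  simp only [gaussPolyFn, eval_mul, eval_X, Complex.real_smul]
  ring

/-- RH-FREE. `(cx) · g(x) = c · (Xg)` on the core. [folklore] -/
private theorem const_mul_X_gaussPolyFn (c : ℂ) (P : ℂ[X]) :
    (fun x : ℝ => (c * x) • gaussPolyFn P x) = fun x => c • gaussPolyFn (X * P) x := by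
  funext x
  simp only [gaussPolyFn, eval_mul, eval_X, smul_eq_mul]
  ring

/-! ## The Fourier transform on integrable functions: additivity and homogeneity (pointwise) -/

/-- RH-FREE. `𝓕(f + g) = 𝓕f + 𝓕g` pointwise for integrable `f, g : ℝ → ℂ`. [folklore] -/
private theorem fourier_add_apply {f g : ℝ → ℂ} (hf : Integrable f) (hg : Integrable g) (w : ℝ) :
    𝓕 (fun x => f x + g x) w = 𝓕 f w + 𝓕 g w := by
  rw [Real.fourier_eq, Real.fourier_eq, Real.fourier_eq, ← integral_add
    ((Real.fourierIntegral_convergent_iff w).2 hf) ((Real.fourierIntegral_convergent_iff w).2 hg)]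
  simp only [smul_add]

/-- RH-FREE. `𝓕(c • f) = c • 𝓕f` pointwise. [folklore] -/
private theorem fourier_const_smul_apply (c : ℂ) (f : ℝ → ℂ) (w : ℝ) :
    𝓕 (fun x => c • f x) w = c • 𝓕 f w := by
  rw [Real.fourier_eq, Real.fourier_eq, ← integral_smul]
  simp only [smul_comm _ c]

/-- RH-FREE. `𝓕(−f) = −𝓕f` pointwise. [folklore] -/
private theorem fourier_neg_apply (f : ℝ → ℂ) (w : ℝ) :
    𝓕 (fun x => -f x) w = -𝓕 f w := by
  have h := fourier_const_smul_apply (-1) f w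
  simp only [neg_one_smul] at h
  exact h

/-! ## Clause (4): `𝓕𝕊 = −𝕊𝓕` on the Gaussian core -/

/-- RH-FREE. `𝓕(P e^{−πx²})` is differentiable with `(𝓕g)′ = 𝓕(−2πix·g)` (Mathlib `Real.hasDerivAt_fourier`;
`g` and `x·g` integrable). [cite: ConnesConsaniMoscovici2024, Prop. 3.1 (ii) p. 10 (p0008:L99–L101)] -/
theorem hasDerivAt_fourier_gaussPolyFn (P : ℂ[X]) (w : ℝ) :
    HasDerivAt (𝓕 (gaussPolyFn P))
      (𝓕 (fun x : ℝ => (-2 * π * I * x) • gaussPolyFn P x) w) w :=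
  Real.hasDerivAt_fourier (integrable_gaussPolyFn P)
    (by rw [smul_gaussPolyFn]; exact integrable_gaussPolyFn _) w

/-- RH-FREE. `(𝓕g)′(w) = −2πi · 𝓕(Xg)(w)` on the core. [cite: ConnesConsaniMoscovici2024, Prop. 3.1 (ii) p. 10 (p0008:L99–L101)] -/
theorem deriv_fourier_gaussPolyFn (P : ℂ[X]) (w : ℝ) :
    deriv (𝓕 (gaussPolyFn P)) w = (-2 * π * I) * 𝓕 (gaussPolyFn (X * P)) w := by
  rw [(hasDerivAt_fourier_gaussPolyFn P w).deriv, const_mul_X_gaussPolyFn, fourier_const_smul_apply,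
    smul_eq_mul]

/-- RH-FREE. `𝓕(g′)(w) = 2πiw · 𝓕g(w)` on the core (Mathlib `Real.fourier_deriv`).
[cite: ConnesConsaniMoscovici2024, Prop. 3.1 (ii) p. 10 (p0008:L99–L101)] -/
theorem fourier_deriv_gaussPolyFn (P : ℂ[X]) (w : ℝ) :
    𝓕 (deriv (gaussPolyFn P)) w = (2 * π * I * w) * 𝓕 (gaussPolyFn P) w := by
  have h := Real.fourier_deriv (integrable_gaussPolyFn P) (contDiff_gaussPolyFn P).differentiable_one
    (by rw [deriv_gaussPolyFn]; exact integrable_gaussPolyFn _)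
  have hw := congrFun h w
  simpa only [smul_eq_mul] using hw

/-- RH-FREE. **The key identity** `𝓕(x·g′)(w) = −(𝓕g(w) + w·(𝓕g)′(w))` for `g = P(x)e^{−πx²}`.
[cite: ConnesConsaniMoscovici2024, Prop. 3.1 (ii) p. 10 (p0008:L99–L101)] -/
theorem fourier_X_mul_deriv_gaussPolyFn (P : ℂ[X]) (w : ℝ) :
    𝓕 (fun x : ℝ => (x : ℂ) * deriv (gaussPolyFn P) x) w =
      -(𝓕 (gaussPolyFn P) w + (w : ℂ) * deriv (𝓕 (gaussPolyFn P)) w) := by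
  -- `g′ = P₁ e^{−πx²}`
  set P₁ : ℂ[X] := derivative P - C (2 * π : ℂ) * X * P with hP₁
  have hg' : deriv (gaussPolyFn P) = gaussPolyFn P₁ := deriv_gaussPolyFn P
  -- left side: `𝓕(X P₁ γ)(w) = (−2πi)⁻¹ (𝓕 (P₁γ))′(w)`
  have h1 : (fun x : ℝ => (x : ℂ) * deriv (gaussPolyFn P) x) = gaussPolyFn (X * P₁) := by
    rw [hg', ← smul_gaussPolyFn]
    funext x
    rw [Complex.real_smul]
  have h2 : deriv (𝓕 (gaussPolyFn P₁)) w = (-2 * π * I) * 𝓕 (gaussPolyFn (X * P₁)) w :=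
    deriv_fourier_gaussPolyFn P₁ w
  -- `𝓕 (P₁γ) = 𝓕 (g′) = 2πi ξ 𝓕 g`
  have h3 : 𝓕 (gaussPolyFn P₁) = fun ξ : ℝ => (2 * π * I * ξ) * 𝓕 (gaussPolyFn P) ξ := by
    funext ξ
    rw [← hg', fourier_deriv_gaussPolyFn]
  have h4 : deriv (𝓕 (gaussPolyFn P₁)) w =
      2 * π * I * 𝓕 (gaussPolyFn P) w + 2 * π * I * w * deriv (𝓕 (gaussPolyFn P)) w := by
    rw [h3]
    have hd : HasDerivAt (fun ξ : ℝ => (2 * π * I * ξ) * 𝓕 (gaussPolyFn P) ξ)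
        (2 * π * I * 1 * 𝓕 (gaussPolyFn P) w +
          2 * π * I * w * deriv (𝓕 (gaussPolyFn P)) w) w := by
      have hl : HasDerivAt (fun ξ : ℝ => 2 * π * I * (ξ : ℂ)) (2 * π * I * 1) w :=
        (Complex.ofRealCLM.hasDerivAt.const_mul (2 * π * I)).congr_deriv (by simp)
      exact hl.mul (hasDerivAt_fourier_gaussPolyFn P w).differentiableAt.hasDerivAt
    rw [hd.deriv, mul_one]
  have hπ : (-2 * π * I : ℂ) ≠ 0 := by
    simp [Real.pi_ne_zero, Complex.I_ne_zero]
  rw [h1]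
  have h5 : 𝓕 (gaussPolyFn (X * P₁)) w = (-2 * π * I)⁻¹ * deriv (𝓕 (gaussPolyFn P₁)) w := by
    rw [h2, ← mul_assoc, inv_mul_cancel₀ hπ, one_mul]
  rw [h5, h4]
  field_simp

/-- RH-FREE. **Proposition 3.1 (ii), second half — `𝔽_{e_ℝ}𝕊 = −𝕊𝔽_{e_ℝ}` on the Gaussian core**:
for `g = P(x)e^{−πx²}` and `𝕊 = −i(x∂ₓ + ½)`, `𝓕(𝕊g) = −𝕊(𝓕g)` pointwise.
[cite: ConnesConsaniMoscovici2024, Prop. 3.1 (ii) p. 10 (p0008:L99–L101); §3.2 eq. (15) p. 10] -/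
theorem fourier_scalingOpFun_gaussPolyFn (P : ℂ[X]) (x : ℝ) :
    𝓕 (scalingOpFun (gaussPolyFn P)) x = -scalingOpFun (𝓕 (gaussPolyFn P)) x := by
  -- `𝕊g = −i·(x g′) + (−i/2)·g`, both integrable pieces on the core
  have hsplit : scalingOpFun (gaussPolyFn P) = fun y : ℝ =>
      (-I) • ((y : ℂ) * deriv (gaussPolyFn P) y) + (-I / 2) • gaussPolyFn P y := by
    funext y
    simp only [scalingOpFun, smul_eq_mul]
    ring
  have hi1 : Integrable (fun y : ℝ => (y : ℂ) * deriv (gaussPolyFn P) y) := by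
    have : (fun y : ℝ => (y : ℂ) * deriv (gaussPolyFn P) y) =
        gaussPolyFn (X * (derivative P - C (2 * π : ℂ) * X * P)) := by
      rw [deriv_gaussPolyFn, ← smul_gaussPolyFn]
      funext y
      rw [Complex.real_smul]
    rw [this]
    exact integrable_gaussPolyFn _
  have hi1' : Integrable (fun y : ℝ => (-I) • ((y : ℂ) * deriv (gaussPolyFn P) y)) := hi1.smul (-I)
  have hi2' : Integrable (fun y : ℝ => (-I / 2) • gaussPolyFn P y) :=
    (integrable_gaussPolyFn P).smul (-I / 2)
  rw [hsplit, fourier_add_apply hi1' hi2', fourier_const_smul_apply,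
    fourier_const_smul_apply, fourier_X_mul_deriv_gaussPolyFn, scalingOpFun]
  simp only [smul_eq_mul]
  ring

/-! ## Clause (2): `𝓕 h₀ = h₀` -/

/-- RH-FREE. **Proposition 3.1 (ii), first half — `𝔽_{e_ℝ} h_0 = h_0`** for `h_0 = 2^{1/4}e^{−πx²}`
(Mathlib: `e^{−πx²}` is its own Fourier transform). [cite: ConnesConsaniMoscovici2024, Prop. 3.1 (ii) p. 10 (p0008:L99); §3.2 p. 10 (p0008:L72)] -/
theorem fourier_toC_hermiteH0 : 𝓕 (toC hermiteH0) = toC hermiteH0 := by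
  have hc : toC hermiteH0 = fun x : ℝ =>
      ((((2 : ℝ) ^ ((1 : ℝ) / 4) : ℝ)) : ℂ) • cexp (-π * (1 : ℂ) * (x : ℂ) ^ 2) := by
    funext x
    simp only [toC, hermiteH0, Complex.ofReal_mul, Complex.ofReal_exp, smul_eq_mul]
    push_cast
    ring_nf
  have hG := fourier_gaussian_pi (b := 1) (by simp)
  funext w
  rw [hc, fourier_const_smul_apply, hG]
  simp

/-! ## Clause (3): `𝓕² = 1` on `L²(ℝ)^{ev}` — the tree theorem, cited -/

/-- RH-FREE. **Proposition 3.1 (ii): `𝔽_{e_ℝ}² = 1` on `L²(ℝ)^{ev}`** — this is seat gm-t15's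
`ConnesConsani2021.fourier_fourier_of_mem_evenPart` (`𝓕𝓕 = R` on `L²(ℝ)`, `R = 1` on even functions),
restated in the fact's spelling. [cite: ConnesConsaniMoscovici2024, Prop. 3.1 (ii) p. 10 (p0008:L99–L101)] -/
theorem fourier_fourier_evenPart (ξ : Lp ℂ 2 (volume : Measure ℝ)) (hξ : ξ ∈ evenPart) :
    (𝓕 (𝓕 ξ : Lp ℂ 2 (volume : Measure ℝ)) : Lp ℂ 2 (volume : Measure ℝ)) = ξ :=
  fourier_fourier_of_mem_evenPart hξ

/-! ## Clause (1): the Gaussian core is dense in `L²(ℝ)^{ev}` -/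

section Density

open Literature.Analysis.SegalBargmann

/-- RH-FREE. For `u ∈ L²(ℝ)`, `u · x^n e^{−πx²}` is integrable. [folklore] -/
private theorem integrable_mul_monoGauss {u : ℝ → ℂ} (hu : MemLp u 2 volume) (n : ℕ) :
    Integrable (fun x : ℝ => u x * monoGauss n x) :=
  hu.integrable_mul (memLp_monoGauss n)

/-- RH-FREE. On `ℝ^{Unit}` the Gaussian of `FockHermite` is `e^{−πx²}` in the single coordinate.
[folklore] -/
private theorem gauss_unit (v : Unit → ℝ) :
    gauss v = ((Real.exp (-π * (v ()) ^ 2) : ℝ) : ℂ) := by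
  simp only [gauss, Fintype.sum_unique, Complex.ofReal_exp]
  push_cast
  rfl

/-- RH-FREE. On `ℝ^{Unit}`, the Hermite-type function with symbol `X^n` is the monomial Gaussian.
[folklore] -/
private theorem hermiteFun_X_pow_unit (n : ℕ) (v : Unit → ℝ) :
    hermiteFun ((MvPolynomial.X () : MvPolynomial Unit ℂ) ^ n) v = monoGauss n (v ()) := by
  rw [hermiteFun, map_pow, MvPolynomial.eval_X, gauss_unit, monoGauss_apply]

/-- RH-FREE. **Completeness of the Hermite functions on `ℝ`** (Folland §1.7 (vii) in dimension one,
transported from the tree's `ℝ^σ` statement along `ℝ^{Unit} ≃ ℝ`): if `u ∈ L²(ℝ)` satisfies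
`∫ u(x) x^n e^{−πx²} dx = 0` for every `n`, then `u = 0` a.e.  (Thm. 3.1: "the `h_n` form an
orthonormal basis" — the completeness half.)
[cite: ConnesConsaniMoscovici2024, Thm. 3.1 p. 10 (p0008:L23); Folland1989, §1.7 (vii)] -/
theorem ae_eq_zero_of_forall_integral_mul_pow_gauss {u : ℝ → ℂ} (hu : MemLp u 2 volume)
    (horth : ∀ n : ℕ, ∫ x : ℝ, u x * (((x ^ n * Real.exp (-π * x ^ 2) : ℝ)) : ℂ) = 0) :
    u =ᵐ[volume] 0 := by
  -- transport to `Unit → ℝ`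
  set e : (Unit → ℝ) ≃ᵐ ℝ := MeasurableEquiv.funUnique Unit ℝ with he_def
  have he : MeasurePreserving e volume volume := volume_preserving_funUnique Unit ℝ
  have heapp : ∀ v : Unit → ℝ, e v = v () := fun v => rfl
  set g : (Unit → ℝ) → ℂ := u ∘ e with hg_def
  have hg : MemLp g 2 volume := hu.comp_measurePreserving he
  -- the test functional `p ↦ ∫ g · (p γ)` vanishes on the monomial basis, hence identically
  have hmono : ∀ n : ℕ, testFn g hg ((MvPolynomial.X () : MvPolynomial Unit ℂ) ^ n) = 0 := by
    intro n
    rw [testFn_apply]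
    have hfun : (fun v : Unit → ℝ => g v * hermiteFun ((MvPolynomial.X () : MvPolynomial Unit ℂ) ^ n) v)
        = fun v => u (e v) * monoGauss n (e v) := by
      funext v
      simp only [hermiteFun_X_pow_unit, hg_def, heapp, Function.comp_apply]
    rw [hfun]
    exact (he.integral_comp e.measurableEmbedding (fun x : ℝ => u x * monoGauss n x)).trans (horth n)
  have hzero : testFn g hg = 0 := by
    refine (MvPolynomial.basisMonomials Unit ℂ).ext fun d => ?_
    rw [LinearMap.zero_apply, MvPolynomial.coe_basisMonomials]
    have hd : (MvPolynomial.monomial d (1 : ℂ)) = (MvPolynomial.X () : MvPolynomial Unit ℂ) ^ (d ()) := by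
      rw [MvPolynomial.X_pow_eq_monomial]
      exact congrArg (fun m : Unit →₀ ℕ => MvPolynomial.monomial m (1 : ℂ)) (Finsupp.unique_single d)
    dsimp only
    rw [hd]
    exact hmono _
  have horth' : ∀ α : Unit →₀ ℕ,
      ∫ v : Unit → ℝ, g v * starRingEnd ℂ (hermiteFun (herm α) v) = 0 := by
    intro α
    have h := congrArg (fun L : MvPolynomial Unit ℂ →ₗ[ℂ] ℂ => L (MvPolynomial.map (starRingEnd ℂ) (herm α)))
      hzero
    simp only [LinearMap.zero_apply, testFn_apply] at h
    rw [← h]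
    refine integral_congr_ae (Filter.Eventually.of_forall fun v => ?_)
    simp only [conj_hermiteFun]
  have hg0 : g =ᵐ[volume] 0 := hermite_complete hg horth'
  -- back to `ℝ`
  have hback := (he.symm e).quasiMeasurePreserving.ae_eq_comp hg0
  have hcomp : g ∘ e.symm = u := by
    funext x
    simp only [hg_def, Function.comp_apply, e.apply_symm_apply]
  rw [hcomp] at hback
  simpa using hback

/-- RH-FREE. The monomial Gaussian as an element of the Hilbert space `L²(ℝ)`. [folklore] -/
private def monoL2 (n : ℕ) : Lp ℂ 2 (volume : Measure ℝ) := (memLp_monoGauss n).toLp (monoGauss n)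

/-- RH-FREE. The `L²` class `monoL2 n` is represented by the monomial Gaussian. [folklore] -/
private theorem monoL2_coeFn (n : ℕ) : ⇑(monoL2 n) =ᵐ[volume] monoGauss n :=
  MemLp.coeFn_toLp _

/-- RH-FREE. `⟪x^n e^{−πx²}, w⟫_{L²} = ∫ w(x) x^n e^{−πx²} dx` (the monomial Gaussian is real).
[folklore] -/
private theorem inner_monoL2_left (n : ℕ) (w : Lp ℂ 2 (volume : Measure ℝ)) :
    ⟪monoL2 n, w⟫_ℂ = ∫ x : ℝ, (w : ℝ → ℂ) x * monoGauss n x := by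
  rw [L2.inner_def]
  refine integral_congr_ae ?_
  filter_upwards [monoL2_coeFn n] with x hx
  rw [hx, RCLike.inner_apply, monoGauss, Complex.conj_ofReal, mul_comm]

/-- RH-FREE. The even monomial Gaussians are even: `monoL2 (2k) ∈ evenPart`. [folklore] -/
private theorem monoL2_even_mem (k : ℕ) : monoL2 (2 * k) ∈ evenPart := by
  rw [mem_evenPart_iff]
  have h := monoL2_coeFn (2 * k)
  have h' := (Measure.measurePreserving_neg (volume : Measure ℝ)).quasiMeasurePreserving.ae_eq_comp h
  filter_upwards [h, h'] with x hx hx'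
  simp only [Function.comp_apply] at hx'
  rw [hx', hx]
  simp only [monoGauss, even_two, Even.mul_right, Even.neg_pow]

/-- RH-FREE. **Parity**: an a.e.-even `w ∈ L²(ℝ)` is orthogonal to the odd monomial Gaussians
(`∫ w(x) x^{2k+1} e^{−πx²} dx = 0` by `x ↦ −x`). [folklore] -/
private theorem integral_mul_monoGauss_odd_eq_zero {w : Lp ℂ 2 (volume : Measure ℝ)}
    (hw : w ∈ evenPart) (k : ℕ) :
    ∫ x : ℝ, (w : ℝ → ℂ) x * monoGauss (2 * k + 1) x = 0 := by
  set F : ℝ → ℂ := fun x => (w : ℝ → ℂ) x * monoGauss (2 * k + 1) x with hF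
  have hneg : ∫ x : ℝ, F (-x) = ∫ x : ℝ, F x :=
    (Measure.measurePreserving_neg (volume : Measure ℝ)).integral_comp
      (Homeomorph.neg ℝ).measurableEmbedding F
  have hodd : ∀ x : ℝ, monoGauss (2 * k + 1) (-x) = -monoGauss (2 * k + 1) x := by
    intro x
    simp only [monoGauss, Odd.neg_pow (⟨k, rfl⟩ : Odd (2 * k + 1)), neg_sq, neg_mul,
      Complex.ofReal_neg]
  have hae : (fun x : ℝ => F (-x)) =ᵐ[volume] fun x => -F x := by
    filter_upwards [mem_evenPart_iff.1 hw] with x hx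
    simp only [hF, hx, hodd, mul_neg]
  rw [integral_congr_ae hae, integral_neg] at hneg
  -- `−I = I` forces `I = 0`
  have : (2 : ℂ) * ∫ x : ℝ, F x = 0 := by linear_combination -hneg
  simpa using this

/-- RH-FREE. The closed span `K` of the even monomial Gaussians inside `L²(ℝ)`. [folklore] -/
private def evenCore : Submodule ℂ (Lp ℂ 2 (volume : Measure ℝ)) :=
  (Submodule.span ℂ (Set.range fun k : ℕ => monoL2 (2 * k))).topologicalClosure

/-- RH-FREE. `K ⊆ L²(ℝ)^{ev}` (even generators, closed even subspace). [folklore] -/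
private theorem evenCore_le_evenPart : evenCore ≤ evenPart := by
  refine Submodule.topologicalClosure_minimal _ ?_ isClosed_evenPart
  rw [Submodule.span_le]
  rintro _ ⟨k, rfl⟩
  exact monoL2_even_mem k

/-- RH-FREE. The generators lie in `K`. [folklore] -/
private theorem monoL2_mem_evenCore (k : ℕ) : monoL2 (2 * k) ∈ evenCore :=
  Submodule.le_topologicalClosure _ (Submodule.subset_span ⟨k, rfl⟩)

/-- RH-FREE. **`L²(ℝ)^{ev} ⊆ K`**: every even `ξ` lies in the closed span of the even monomial
Gaussians (orthogonal decomposition `ξ = y + z` in `K ⊕ K^⊥`; `z` is even, orthogonal to the even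
monomials by construction and to the odd ones by parity, hence `z = 0` by Hermite completeness).
[cite: ConnesConsaniMoscovici2024, Prop. 3.1 (i) p. 10 (p0008:L92–L95); Folland1989, §1.7 (vii)] -/
private theorem mem_evenCore_of_mem_evenPart {ξ : Lp ℂ 2 (volume : Measure ℝ)} (hξ : ξ ∈ evenPart) :
    ξ ∈ evenCore := by
  haveI : CompleteSpace evenCore := (Submodule.isClosed_topologicalClosure _).completeSpace_coe
  obtain ⟨y, hy, z, hz, hyz⟩ := Submodule.exists_add_mem_mem_orthogonal (K := evenCore) ξ
  -- `z` is even
  have hzev : z ∈ evenPart := by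
    have : z = ξ - y := by rw [hyz]; abel
    rw [this]
    exact Submodule.sub_mem _ hξ (evenCore_le_evenPart hy)
  -- `z` is orthogonal to every monomial Gaussian
  have hall : ∀ n : ℕ, ∫ x : ℝ, (z : ℝ → ℂ) x * monoGauss n x = 0 := by
    intro n
    obtain ⟨k, rfl | rfl⟩ := Nat.even_or_odd' n
    · rw [← inner_monoL2_left]
      exact Submodule.inner_right_of_mem_orthogonal (monoL2_mem_evenCore k) hz
    · exact integral_mul_monoGauss_odd_eq_zero hzev k
  -- hence `z = 0`
  have hz0 : z = 0 := by
    rw [Lp.eq_zero_iff_ae_eq_zero]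
    exact ae_eq_zero_of_forall_integral_mul_pow_gauss (Lp.memLp z) (fun n => by
      simpa only [monoGauss] using hall n)
  rw [hyz, hz0, add_zero]
  exact hy

/-- RH-FREE. Almost-everywhere form of a finite sum in `L²`. [folklore] -/
private theorem coeFn_finset_sum {ι : Type*} (s : Finset ι) (f : ι → Lp ℂ 2 (volume : Measure ℝ)) :
    ⇑(∑ j ∈ s, f j) =ᵐ[volume] fun x => ∑ j ∈ s, (f j : ℝ → ℂ) x := by
  classical
  induction s using Finset.induction_on with
  | empty =>
    simp only [Finset.sum_empty]
    exact Lp.coeFn_zero ℂ 2 (volume : Measure ℝ)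
  | insert a s ha ih =>
    rw [Finset.sum_insert ha]
    filter_upwards [Lp.coeFn_add (f a) (∑ j ∈ s, f j), ih] with x hx hx'
    rw [hx, Pi.add_apply, hx', Finset.sum_insert ha]

/-- RH-FREE. A finite combination of even monomial Gaussians is `P(x²)e^{−πx²}` for a polynomial `P`.
[cite: ConnesConsaniMoscovici2024, Prop. 3.2 (ii) p. 11 (p0008:L115–L121)] -/
private theorem exists_poly_of_finsupp (c : ℕ →₀ ℂ) :
    ∃ P : ℂ[X], ∀ x : ℝ,
      ∑ i ∈ c.support, c i * monoGauss (2 * i) x = gaussPolyFn (P.comp (X ^ 2)) x := by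
  refine ⟨∑ i ∈ c.support, C (c i) * X ^ i, fun x => ?_⟩
  rw [gaussPolyFn, eval_comp, eval_pow, eval_X, eval_finsetSum, Finset.sum_mul]
  refine Finset.sum_congr rfl fun i _ => ?_
  rw [eval_mul, eval_C, eval_pow, eval_X, monoGauss_apply, pow_mul]
  ring

/-- RH-FREE. **Proposition 3.1 (i) — cyclicity: the Gaussian core `{P(x²)e^{−πx²}}` is dense in
`L²(ℝ)^{ev}`.**  For every even `ξ ∈ L²(ℝ)` and `ε > 0` there is a polynomial `P` with
`‖ξ − P(x²)e^{−πx²}‖_{L²} < ε`.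
[cite: ConnesConsaniMoscovici2024, Prop. 3.1 (i) p. 10 (p0008:L92–L95); Prop. 3.2 (ii) p. 11] -/
theorem exists_gaussPolyFn_comp_X_sq_near {ξ : Lp ℂ 2 (volume : Measure ℝ)} (hξ : ξ ∈ evenPart)
    {ε : ℝ} (hε : 0 < ε) :
    ∃ P : ℂ[X],
      eLpNorm (fun x : ℝ => (ξ : ℝ → ℂ) x - gaussPolyFn (P.comp (X ^ 2)) x) 2 volume
        < ENNReal.ofReal ε := by
  have hmem : ξ ∈ closure (Submodule.span ℂ (Set.range fun k : ℕ => monoL2 (2 * k)) :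
      Set (Lp ℂ 2 (volume : Measure ℝ))) := by
    rw [← Submodule.topologicalClosure_coe]
    exact mem_evenCore_of_mem_evenPart hξ
  obtain ⟨s, hs, hdist⟩ := Metric.mem_closure_iff.1 hmem ε hε
  obtain ⟨c, rfl⟩ := (Finsupp.mem_span_range_iff_exists_finsupp.1 hs)
  obtain ⟨P, hP⟩ := exists_poly_of_finsupp c
  refine ⟨P, ?_⟩
  -- the `L²` distance is the norm of the difference in `Lp`
  have h1 := coeFn_finset_sum c.support (fun i => c i • monoL2 (2 * i))
  have h2 : ∀ i ∈ c.support, ∀ᵐ x ∂(volume : Measure ℝ),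
      ((c i • monoL2 (2 * i) : Lp ℂ 2 (volume : Measure ℝ)) : ℝ → ℂ) x =
        c i * monoGauss (2 * i) x := fun i _ => by
    filter_upwards [Lp.coeFn_smul (c i) (monoL2 (2 * i)), monoL2_coeFn (2 * i)] with x hx hx'
    rw [hx, Pi.smul_apply, hx', smul_eq_mul]
  have h3 := (Finset.eventually_all c.support).2 h2
  have hcoe : ((c.sum fun i a => a • monoL2 (2 * i) : Lp ℂ 2 (volume : Measure ℝ)) : ℝ → ℂ)
      =ᵐ[volume] fun x => gaussPolyFn (P.comp (X ^ 2)) x := by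
    filter_upwards [h1, h3] with x hx hx3
    rw [Finsupp.sum, hx, Finset.sum_congr rfl hx3, hP x]
  set t : Lp ℂ 2 (volume : Measure ℝ) := c.sum fun i a => a • monoL2 (2 * i) with ht
  have hsub : (fun x : ℝ => (ξ : ℝ → ℂ) x - gaussPolyFn (P.comp (X ^ 2)) x) =ᵐ[volume]
      ((ξ - t : Lp ℂ 2 (volume : Measure ℝ)) : ℝ → ℂ) := by
    filter_upwards [Lp.coeFn_sub ξ t, hcoe] with x hx hx'
    rw [hx, Pi.sub_apply, hx']
  rw [eLpNorm_congr_ae hsub, ← Lp.enorm_def, ← ofReal_norm, ← dist_eq_norm,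
    ENNReal.ofReal_lt_ofReal_iff hε]
  exact hdist

end Density

/-! ## Assembly -/

/-- RH-FREE. **Connes–Consani–Moscovici 2024, Proposition 3.1 — DISCHARGED** (`theorem … : CCM2024_prop_3_1`):
(i) the cyclicity of `(𝕊, h₀)` = density of the Gaussian core `{P(x²)e^{−πx²}}` in `L²(ℝ)^{ev}`
(Hermite completeness, Folland §1.7 (vii), inside the closed even subspace); (ii) `𝓕h₀ = h₀` (Gaussian
self-duality), `𝓕² = 1` on `L²(ℝ)^{ev}` (seat gm-t15's `fourier_fourier_of_mem_evenPart`), and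
`𝓕𝕊 = −𝕊𝓕` on the core (Fourier transform of `x g′`).  RH-FREE corpus literature.
[cite: ConnesConsaniMoscovici2024, Prop. 3.1 p. 10 (p0008:L89–L101)] -/
theorem CCM2024_prop_3_1_holds : CCM2024_prop_3_1 :=
  ⟨fun _ hξ _ hε => exists_gaussPolyFn_comp_X_sq_near hξ hε, fourier_toC_hermiteH0,
    fun ξ hξ => fourier_fourier_evenPart ξ hξ, fourier_scalingOpFun_gaussPolyFn⟩

end Literature.NumberTheory.ConnesConsani2024

end
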